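import Mathlib.MeasureTheory.Function.JacobianOneDim
import Mathlib.Analysis.Calculus.FDeriv.Measurable
import Mathlib.Analysis.Calculus.Monotone
import Mathlib.MeasureTheory.Measure.Hausdorff
import Mathlib.Topology.Order.IntermediateValue
import HarnessLib

/-!
# Change of variables for Lipschitz shears of the line: `∫ (1 + t') u(r + t(r)) dr = ∫ u`

Topic `Literature/MeasureTheory/Lebesgue` (namespace `Literature.MeasureTheory.Lebesgue`). The
"Lebesgue transformation theorem" in the form used by Richthammer for the density of a deformed
Poisson process [Richthammer2007, §6.2 (6.1) and §6.6]: if `t : ℝ → ℝ` is Lipschitz with constant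
`L < 1`, then `F = id + t` is a strictly increasing bi-Lipschitz bijection of `ℝ`, differentiable
almost everywhere, and for EVERY `u : ℝ → [0, ∞]`
`∫ (1 + t'(r)) u(r + t(r)) dr = ∫ u(r') dr'`.
Since `t'` exists only almost everywhere, and since the applications need the Jacobian factor as
an honest (jointly measurable) function when `t` depends measurably on parameters, the
derivative is replaced by the **sequential difference quotient** `seqDeriv t r =
liminf_m (m+1) (t(r + 1/(m+1)) - t(r))`, which agrees with `deriv t r` at every point of
differentiability (`seqDeriv_eq_deriv`), is measurable jointly in any measurable parameter
(`measurable_seqDeriv_uncurry`), and is bounded by the Lipschitz constant (`abs_seqDeriv_le`).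

Main results (all proved):
* `strictMono_id_add`, `surjective_id_add`, `lipschitzWith_id_add` — `F = id + t`;
* `volume_image_null_of_lipschitz` — Lipschitz maps of `ℝ` send null sets to null sets
  (`μH[1] = volume`);
* `lintegral_one_add_seqDeriv_mul_comp` — **the substitution rule** above, from Mathlib's
  `lintegral_image_eq_lintegral_deriv_mul_of_monotoneOn` on the (full-measure) set of
  differentiability points (`Monotone.ae_differentiableAt`).

## References

* [Richthammer2007] T. Richthammer, *Translation-invariance of two-dimensional Gibbsian point
  processes*, Comm. Math. Phys. 274 (2007) 81–122, arXiv:0706.3637: §6.2 (6.1) (p. 13), §6.6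
  (p. 16).
-/

noncomputable section

namespace Literature.MeasureTheory.Lebesgue

open _root_.MeasureTheory Filter Set Function
open scoped ENNReal NNReal Topology

/-! ### The sequential difference quotient -/

/-- The **sequential (right) difference quotient** of `t` at `r`:
`liminf_{m → ∞} (m+1) (t(r + 1/(m+1)) - t(r))`. A measurable substitute for `deriv t r`, to
which it is equal wherever `t` is differentiable. [folklore] -/
def seqDeriv (t : ℝ → ℝ) (r : ℝ) : ℝ :=
  Filter.liminf (fun m : ℕ => ((m : ℝ) + 1) * (t (r + ((m : ℝ) + 1)⁻¹) - t r)) atTop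

/-- The defining sequence of `seqDeriv`. [folklore] -/
theorem seqDeriv_def (t : ℝ → ℝ) (r : ℝ) : seqDeriv t r =
    Filter.liminf (fun m : ℕ => ((m : ℝ) + 1) * (t (r + ((m : ℝ) + 1)⁻¹) - t r)) atTop := rfl

/-- At a point of differentiability the sequential difference quotient is the derivative.
[folklore] -/
theorem seqDeriv_eq_deriv {t : ℝ → ℝ} {r : ℝ} (h : DifferentiableAt ℝ t r) :
    seqDeriv t r = deriv t r := by
  have hd : HasDerivAt t (deriv t r) r := h.hasDerivAt
  rw [hasDerivAt_iff_tendsto_slope] at hd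
  -- the sequence `r + 1/(m+1)` tends to `r` within `{r}ᶜ`
  have hseq : Tendsto (fun m : ℕ => r + ((m : ℝ) + 1)⁻¹) atTop (𝓝[≠] r) := by
    refine tendsto_nhdsWithin_iff.2 ⟨?_, Eventually.of_forall fun m => ?_⟩
    · have h1 : Tendsto (fun m : ℕ => ((m : ℝ) + 1)⁻¹) atTop (𝓝 0) :=
        tendsto_inv_atTop_zero.comp (tendsto_natCast_atTop_atTop.atTop_add tendsto_const_nhds)
      simpa using tendsto_const_nhds.add h1
    · have : (0 : ℝ) < ((m : ℝ) + 1)⁻¹ := by positivity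
      simp only [mem_compl_iff, mem_singleton_iff, add_eq_left]
      exact this.ne'
  have hlim := hd.comp hseq
  have heq : (slope t r ∘ fun m : ℕ => r + ((m : ℝ) + 1)⁻¹) =
      fun m : ℕ => ((m : ℝ) + 1) * (t (r + ((m : ℝ) + 1)⁻¹) - t r) := by
    funext m
    simp only [comp_apply, slope_def_field, add_sub_cancel_left]
    rw [div_eq_mul_inv, inv_inv, mul_comm]
  rw [heq] at hlim
  exact hlim.liminf_eq

/-- **Joint measurability**: if `t` depends measurably on a parameter, so does `seqDeriv t`.
[folklore] -/
theorem measurable_seqDeriv_uncurry {α : Type*} [MeasurableSpace α] {t : α → ℝ → ℝ}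
    (ht : Measurable (Function.uncurry t)) :
    Measurable fun p : α × ℝ => seqDeriv (t p.1) p.2 := by
  unfold seqDeriv
  refine Measurable.liminf fun m => ?_
  refine measurable_const.mul ((ht.comp (measurable_fst.prodMk (measurable_snd.add_const _))).sub
    (ht.comp (measurable_fst.prodMk measurable_snd)))

/-- Measurability of `seqDeriv t` for measurable `t`. [folklore] -/
theorem measurable_seqDeriv {t : ℝ → ℝ} (ht : Measurable t) : Measurable (seqDeriv t) := by
  unfold seqDeriv
  refine Measurable.liminf fun m => ?_
  exact measurable_const.mul ((ht.comp (measurable_id.add_const _)).sub ht)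

/-- The difference quotients of an `L`-Lipschitz function are bounded by `L`. [folklore] -/
theorem abs_mul_sub_le_of_lipschitz {L : ℝ≥0} {t : ℝ → ℝ} (ht : LipschitzWith L t) (r : ℝ)
    (m : ℕ) : |((m : ℝ) + 1) * (t (r + ((m : ℝ) + 1)⁻¹) - t r)| ≤ L := by
  have hm : (0 : ℝ) < (m : ℝ) + 1 := by positivity
  have h : |t (r + ((m : ℝ) + 1)⁻¹) - t r| ≤ L * ((m : ℝ) + 1)⁻¹ := by
    have h0 := ht.dist_le_mul (r + ((m : ℝ) + 1)⁻¹) r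
    rw [Real.dist_eq, Real.dist_eq] at h0
    have h1 : |r + ((m : ℝ) + 1)⁻¹ - r| = ((m : ℝ) + 1)⁻¹ := by
      rw [add_sub_cancel_left, abs_of_pos (inv_pos.2 hm)]
    rwa [h1] at h0
  rw [abs_mul, abs_of_pos hm]
  calc ((m : ℝ) + 1) * |t (r + ((m : ℝ) + 1)⁻¹) - t r|
      ≤ ((m : ℝ) + 1) * (L * ((m : ℝ) + 1)⁻¹) := mul_le_mul_of_nonneg_left h hm.le
    _ = L := by rw [mul_comm (L : ℝ), ← mul_assoc, mul_inv_cancel₀ hm.ne', one_mul]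

/-- **`|seqDeriv t| ≤ L`** for an `L`-Lipschitz `t` (everywhere, not only almost everywhere).
[folklore] -/
theorem abs_seqDeriv_le {L : ℝ≥0} {t : ℝ → ℝ} (ht : LipschitzWith L t) (r : ℝ) :
    |seqDeriv t r| ≤ L := by
  have hb : ∀ m : ℕ, ((m : ℝ) + 1) * (t (r + ((m : ℝ) + 1)⁻¹) - t r) ∈ Set.Icc (-(L : ℝ)) L :=
    fun m => abs_le.1 (abs_mul_sub_le_of_lipschitz ht r m)
  have hbdd_above : IsBoundedUnder (· ≤ ·) atTop
      (fun m : ℕ => ((m : ℝ) + 1) * (t (r + ((m : ℝ) + 1)⁻¹) - t r)) :=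
    isBoundedUnder_of ⟨L, fun m => (hb m).2⟩
  have hbdd_below : IsBoundedUnder (· ≥ ·) atTop
      (fun m : ℕ => ((m : ℝ) + 1) * (t (r + ((m : ℝ) + 1)⁻¹) - t r)) :=
    isBoundedUnder_of ⟨-(L : ℝ), fun m => (hb m).1⟩
  rw [seqDeriv, abs_le]
  constructor
  · exact le_liminf_of_le hbdd_above.isCoboundedUnder_ge (Eventually.of_forall fun m => (hb m).1)
  · refine liminf_le_of_le hbdd_below fun b hb' => ?_
    obtain ⟨m, hm1, hm2⟩ := (hb'.and (Eventually.of_forall fun m => (hb m).2)).exists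
    exact hm1.trans hm2

/-! ### The shear `F = id + t` -/

/-- `id + t` is strictly increasing when `t` is Lipschitz with constant `< 1`. [folklore] -/
theorem strictMono_id_add {L : ℝ≥0} {t : ℝ → ℝ} (ht : LipschitzWith L t) (hL : L < 1) :
    StrictMono fun r => r + t r := by
  intro a b hab
  have h := ht.dist_le_mul a b
  rw [Real.dist_eq, Real.dist_eq, abs_sub_comm a b, abs_of_pos (sub_pos.2 hab)] at h
  have h' : t a - t b ≤ L * (b - a) := (le_abs_self _).trans h
  have hL' : (L : ℝ) < 1 := by exact_mod_cast hL
  nlinarith [sub_pos.2 hab]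

/-- `id + t` is `(1 + L)`-Lipschitz. [folklore] -/
theorem lipschitzWith_id_add {L : ℝ≥0} {t : ℝ → ℝ} (ht : LipschitzWith L t) :
    LipschitzWith (1 + L) fun r => r + t r :=
  LipschitzWith.id.add ht

/-- `id + t` is onto `ℝ` (continuous, tends to `±∞`). [folklore] -/
theorem surjective_id_add {L : ℝ≥0} {t : ℝ → ℝ} (ht : LipschitzWith L t) (hL : L < 1) :
    Function.Surjective fun r => r + t r := by
  have hL' : (L : ℝ) < 1 := by exact_mod_cast hL
  have hcont : Continuous fun r => r + t r := continuous_id.add ht.continuous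
  have hbound : ∀ r, |t r - t 0| ≤ L * |r| := fun r => by
    have h := ht.dist_le_mul r 0
    rwa [Real.dist_eq, Real.dist_eq, sub_zero] at h
  have hlin_top : Tendsto (fun r : ℝ => (1 - L) * r + t 0) atTop atTop :=
    tendsto_atTop_add_const_right _ _ (tendsto_id.const_mul_atTop (by linarith))
  have hlin_bot : Tendsto (fun r : ℝ => (1 - L) * r + t 0) atBot atBot :=
    tendsto_atBot_add_const_right _ _ (tendsto_id.const_mul_atBot (by linarith))
  refine hcont.surjective ?_ ?_
  · refine tendsto_atTop_mono' atTop ?_ hlin_top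
    filter_upwards [eventually_ge_atTop 0] with r hr
    have h := (abs_le.1 (hbound r)).1
    rw [abs_of_nonneg hr] at h
    linarith
  · refine tendsto_atBot_mono' atBot ?_ hlin_bot
    filter_upwards [eventually_le_atBot 0] with r hr
    have h := (abs_le.1 (hbound r)).2
    rw [abs_of_nonpos hr] at h
    linarith

/-- **Lipschitz maps of the line send null sets to null sets** (via `μH[1] = volume`).
[folklore] -/
theorem volume_image_null_of_lipschitz {K : ℝ≥0} {F : ℝ → ℝ} (hF : LipschitzWith K F)
    {s : Set ℝ} (hs : volume s = 0) : volume (F '' s) = 0 := by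
  rw [← hausdorffMeasure_real] at hs ⊢
  have h := hF.hausdorffMeasure_image_le zero_le_one s
  rw [hs, mul_zero] at h
  exact le_antisymm h bot_le

/-! ### The substitution rule -/

/-- **Change of variables for a Lipschitz shear of the line.** If `t : ℝ → ℝ` is Lipschitz with
constant `L < 1` then for every `u : ℝ → [0, ∞]`,
`∫ (1 + seqDeriv t r) u(r + t r) dr = ∫ u(r') dr'` — the Lebesgue transformation theorem
`∫ g(f(x)) |f'(x)| dx = ∫ g(x') dx'` for the strictly increasing, a.e. differentiable bijection
`f = id + t`, with `f' = 1 + t' ≥ 1 - L > 0` replaced by its everywhere-defined measurable version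
`1 + seqDeriv t`. [cite: Richthammer2007, §6.2 (6.1) (p. 13)] -/
theorem lintegral_one_add_seqDeriv_mul_comp {L : ℝ≥0} {t : ℝ → ℝ} (ht : LipschitzWith L t)
    (hL : L < 1) (u : ℝ → ℝ≥0∞) :
    ∫⁻ r, ENNReal.ofReal (1 + seqDeriv t r) * u (r + t r) = ∫⁻ r, u r := by
  set F : ℝ → ℝ := fun r => r + t r with hF
  have hmono : StrictMono F := strictMono_id_add ht hL
  have hsurj : Function.Surjective F := surjective_id_add ht hL
  have hlip : LipschitzWith (1 + L) F := lipschitzWith_id_add ht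
  -- differentiability points of `F`
  set s : Set ℝ := {r | DifferentiableAt ℝ F r} with hs
  have hsm : MeasurableSet s := measurableSet_of_differentiableAt ℝ F
  have hae : ∀ᵐ r ∂(volume : Measure ℝ), r ∈ s := hmono.monotone.ae_differentiableAt
  have hsc : volume sᶜ = 0 := mem_ae_iff.1 hae
  -- on `s`, `F' = 1 + seqDeriv t`
  have hderiv : ∀ r ∈ s, HasDerivWithinAt F (1 + seqDeriv t r) s r := fun r hr => by
    have hFd : HasDerivAt F (deriv F r) r := (hr : DifferentiableAt ℝ F r).hasDerivAt
    have htd : DifferentiableAt ℝ t r := by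
      have : t = fun x => F x - x := by funext x; simp [hF]
      rw [this]
      exact hr.sub differentiableAt_id
    have hFd' : HasDerivAt F (1 + deriv t r) r := (hasDerivAt_id r).add htd.hasDerivAt
    rw [seqDeriv_eq_deriv htd]
    exact hFd'.hasDerivWithinAt
  -- Mathlib's change of variables on `s`
  have hcv := lintegral_image_eq_lintegral_deriv_mul_of_monotoneOn hsm hderiv
    (hmono.monotone.monotoneOn s) u
  -- the image `F '' s` has full measure
  have himg : volume (F '' s)ᶜ = 0 := by
    have hsub : (F '' s)ᶜ ⊆ F '' sᶜ := by
      intro y hy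
      obtain ⟨x, rfl⟩ := hsurj y
      exact ⟨x, fun hx => hy ⟨x, hx, rfl⟩, rfl⟩
    exact measure_mono_null hsub (volume_image_null_of_lipschitz hlip hsc)
  have h1 : ∫⁻ r in F '' s, u r = ∫⁻ r, u r := by
    rw [Measure.restrict_eq_self_of_ae_mem (mem_ae_iff.2 himg : ∀ᵐ r ∂volume, r ∈ F '' s)]
  have h2 : ∫⁻ r in s, ENNReal.ofReal (1 + seqDeriv t r) * u (F r) =
      ∫⁻ r, ENNReal.ofReal (1 + seqDeriv t r) * u (F r) := by
    rw [Measure.restrict_eq_self_of_ae_mem hae]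
  rw [← h2, ← hcv, h1]

/-- The substitution rule with the roles displayed as an image measure: for measurable `A`,
`volume (F⁻¹' A)`-free form `∫ 1_A(r + t r) (1 + seqDeriv t r) dr = volume A`. [folklore] -/
theorem lintegral_one_add_seqDeriv_mul_indicator_comp {L : ℝ≥0} {t : ℝ → ℝ}
    (ht : LipschitzWith L t) (hL : L < 1) {A : Set ℝ} (hA : MeasurableSet A) :
    ∫⁻ r, ENNReal.ofReal (1 + seqDeriv t r) * A.indicator 1 (r + t r) = volume A := by
  rw [lintegral_one_add_seqDeriv_mul_comp ht hL (A.indicator 1), lintegral_indicator_one hA]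

/-- Positivity of the Jacobian factor almost everywhere is not needed above; everywhere one has
`1 + seqDeriv t r ≥ 1 - L > 0`. [folklore] -/
theorem one_sub_le_one_add_seqDeriv {L : ℝ≥0} {t : ℝ → ℝ} (ht : LipschitzWith L t) (r : ℝ) :
    1 - (L : ℝ) ≤ 1 + seqDeriv t r := by
  have h := (abs_le.1 (abs_seqDeriv_le ht r)).1
  linarith

end Literature.MeasureTheory.Lebesgue

end
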